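import Literature.MathematicalPhysics.QuantumFieldTheory.Balaban1983to89.Beta.LogDetHessian

/-!
# `BalabanUV.Beta.StepDefectTadpole` — binder row D1: **THE STEP DEFECT OF SECOND JETS ALONG A COMPOSITION IS THE FIRST JET
# CONTRACTED WITH THE SECOND RESPONSE** (the calculus certificate of FINDING X-an2-54 «the step defect is a tadpole»)
# (β sub-cell, BINDER-OWNERS row D1 OWNER, lineage an2 gen 23)

HONEST FRAMING (cell charter, verbatim): «discharging BetaPertH makes Balaban's UV stability UNCONDITIONAL — a real
constructive-QFT result; it is NOT the continuum limit and NOT the Clay problem.»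
HONEST DEPENDENCY: continuum YM on T⁴ ⇐ BetaPertH ∧ nine spine estimates (0/9 proved); BetaPertH ⇐ (D1) ∧ (D4) ∧ CAP+tail;
G-an2-4 gates asym, D1 and NE2/3/4.
ABSOLUTE RULE (cell, verbatim): «No internally-minted statement may enter as a cited fact. Every hypothesis is either kernel-proved in this
package or a verbatim quotation of a PUBLISHED theorem with page reference. The manuscript(s) under audit are NOT citable for their own
disputed steps — they are the thing under adjudication; programme-internal (2001/route/tribunal) claims are never citable.»
NOTHING below is cited: no `[cite: …]`, no `def`, no `Prop` fact.  Every declaration is [folklore] differential calculus in real normed spaces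
(Mathlib `fderiv` ∕ `HasFDerivAt.clm_comp` ∕ `contDiffAt_succ_iff_hasFDerivAt` through pv09∕an2's `LogDetHessian.exists_local_fderiv` BY NAME).
It asserts nothing about Bałaban's objects.

WHY (row-D1 owner, gen 23; FINDING X-an2-54, journal 2026-08-20T21:00Z).  The telescoping clause of binder row D1 compares the one-loop kernel of ONE
block-`Lc^{m+1}` step with «the block-`Lc^m` one-shot kernel transported on both legs by the last step's response + the last step's kernel»
(`StepDriftWitness.SD`, `HessianTelescopingKKT.stepDefect`).  For HONEST composite objects all three kernels are SECOND JETS of one-loop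
FUNCTIONALS of the background at the trivial configuration (`LogDetHessian`: `d² log det kkt = tr(K⁻¹d²K) − tr(K⁻¹dK K⁻¹dK)` = the `½·tadpole − ½·bubble`
shape of `ExpKernelCalculus.hessKer`), and Gaussian Fubini (with the linearised Faddeev–Popov quotients; matrix level: an5's
`SliceComposition.det_kkt_comp_sliceChange` ∕ `invariant_readouts_comp_eq_oneShot`) says that AS FUNCTIONS the one-shot functional at `m+1` is the
one-shot functional at `m` composed with the last step's minimiser map, plus the last step's functional, plus a constant.  THIS FILE is the calculus
that then remains: the second jet of a composition `f ∘ U` is the second jet of `f` transported on both legs by `dU` PLUS the first jet of `f`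
contracted with the second response `d²U` (`fderiv_fderiv_comp`); hence under a Fubini hypothesis `Φ = f ∘ U + φ + c` near the base point the STEP
DEFECT `d²Φ − d²f(dU·, dU·) − d²φ` is EXACTLY `df(U x₀) ∘ d²U(x₀)` (`stepDefect_eq_firstJet_secondResponse`) and VANISHES when `f` has no first jet
at `U x₀` — «tadpole-free» (`stepDefect_eq_zero_of_tadpoleFree`).  In the genuine theory tadpole-freeness at the trivial background is global
colour invariance; in the colour-stripped literal it is a table property to be checked (X-an2-54 (4)).  Nothing here is instantiated at the literal.

WHAT (all [folklore]; `E`, `F` real normed spaces — coarse and fine backgrounds —, `G` a real normed space — values):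
§1 `hasFDerivAt_comp_field` (near `x₀`, `d(f ∘ U)(x) = df(U x) ∘ dU(x)` as a field of continuous linear maps), **`fderiv_fderiv_comp`**
   (`d²(f ∘ U)(x₀)[u][v] = d²f(U x₀)[dU u][dU v] + df(U x₀)(d²U(x₀)[u][v])` for `U` of class `C²` at `x₀` and `f` of class `C²` at `U x₀`),
   `fderiv_fderiv_comp_of_fderiv_eq_zero` (tadpole-free case: transported second jet only).
§2 **`stepDefect_eq_firstJet_secondResponse`**: if `Φ =ᶠ[𝓝 x₀] fun x ↦ f (U x) + φ x + c` then
   `d²Φ(x₀)[u][v] − d²f(U x₀)[dU u][dU v] − d²φ(x₀)[u][v] = df(U x₀)(d²U(x₀)[u][v])`; **`stepDefect_eq_zero_of_tadpoleFree`** (`df(U x₀) = 0` ⟹ the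
   step defect vanishes); `secondJet_oneShot_eq_of_tadpoleFree` (the same, solved for `d²Φ`).
Provenance: β sub-cell, unit beta-an2 gen 23 (prover-b2b-balaban-beta-an2-g23-0), 2026-08-20.  NOT (SDF), NOT D1, NOT `BetaPertH`, NOT continuum, NOT Clay.
-/

open Filter Topology
open Literature.MathematicalPhysics.QuantumFieldTheory.Balaban1983to89.Beta.LogDetHessian (exists_local_fderiv)

namespace Summit.QuantumFields.BalabanUV.Beta.StepDefectTadpole

variable {E F G : Type*} [NormedAddCommGroup E] [NormedSpace ℝ E] [NormedAddCommGroup F] [NormedSpace ℝ F]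
  [NormedAddCommGroup G] [NormedSpace ℝ G]

/-! ## §1 The second jet of a composition -/

/-- [folklore] Near `x₀` the derivative of `f ∘ U` is the FIELD `x ↦ df(U x) ∘ dU(x)`, given local derivative fields `U′` of `U` near `x₀` and `f′` of
`f` near `U x₀` (and continuity of `U` at `x₀`). -/
theorem hasFDerivAt_comp_field {U : E → F} {f : F → G} {x₀ : E} {U' : E → E →L[ℝ] F} {f' : F → F →L[ℝ] G}
    (hU' : ∀ᶠ x in 𝓝 x₀, HasFDerivAt U (U' x) x) (hf' : ∀ᶠ y in 𝓝 (U x₀), HasFDerivAt f (f' y) y) (hUc : ContinuousAt U x₀) :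
    ∀ᶠ x in 𝓝 x₀, HasFDerivAt (f ∘ U) ((f' (U x)).comp (U' x)) x := by
  have h2 : ∀ᶠ x in 𝓝 x₀, HasFDerivAt f (f' (U x)) (U x) := hUc.eventually hf'
  exact (hU'.and h2).mono fun x hx => hx.2.comp x hx.1

/-- [folklore] **THE SECOND JET OF A COMPOSITION** (`U` of class `C²` at `x₀`, `f` of class `C²` at `U x₀`):
`d²(f ∘ U)(x₀)[u][v] = d²f(U x₀)[dU(x₀) u][dU(x₀) v] + df(U x₀)(d²U(x₀)[u][v])` — the second jet of `f` TRANSPORTED on both legs by the response `dU`,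
plus the FIRST jet of `f` contracted with the SECOND RESPONSE `d²U`. -/
theorem fderiv_fderiv_comp {U : E → F} {f : F → G} {x₀ : E} (hU : ContDiffAt ℝ 2 U x₀) (hf : ContDiffAt ℝ 2 f (U x₀)) (u v : E) :
    fderiv ℝ (fderiv ℝ (f ∘ U)) x₀ u v =
      fderiv ℝ (fderiv ℝ f) (U x₀) (fderiv ℝ U x₀ u) (fderiv ℝ U x₀ v) + fderiv ℝ f (U x₀) (fderiv ℝ (fderiv ℝ U) x₀ u v) := by
  obtain ⟨U', hU', hU'1⟩ := exists_local_fderiv hU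
  obtain ⟨f', hf', hf'1⟩ := exists_local_fderiv hf
  have hUc : ContinuousAt U x₀ := hU.continuousAt
  -- the first-derivative fields agree with `fderiv` near the points
  have hfU : fderiv ℝ U =ᶠ[𝓝 x₀] U' := hU'.mono fun x hx => hx.fderiv
  have hff : fderiv ℝ f =ᶠ[𝓝 (U x₀)] f' := hf'.mono fun y hy => hy.fderiv
  have hU0 : HasFDerivAt U (U' x₀) x₀ := hU'.self_of_nhds
  have hfU0 : fderiv ℝ U x₀ = U' x₀ := hU0.fderiv
  have hff0 : fderiv ℝ f (U x₀) = f' (U x₀) := (hf'.self_of_nhds).fderiv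
  -- the derivative of the composition, as a field near `x₀`
  have hcomp : fderiv ℝ (f ∘ U) =ᶠ[𝓝 x₀] fun x => (f' (U x)).comp (U' x) :=
    (hasFDerivAt_comp_field hU' hf' hUc).mono fun x hx => hx.fderiv
  -- differentiate the field `x ↦ f'(U x) ∘ U'(x)` at `x₀`
  have hd : HasFDerivAt U' (fderiv ℝ U' x₀) x₀ := (hU'1.differentiableAt one_ne_zero).hasFDerivAt
  have hc : HasFDerivAt (fun x => f' (U x)) ((fderiv ℝ f' (U x₀)).comp (U' x₀)) x₀ :=
    ((hf'1.differentiableAt one_ne_zero).hasFDerivAt).comp x₀ hU0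
  have h2 := (hc.clm_comp hd).congr_of_eventuallyEq hcomp
  rw [h2.fderiv]
  -- identify the second derivatives of the fields with `fderiv (fderiv ·)`
  have e1 : fderiv ℝ (fderiv ℝ U) x₀ = fderiv ℝ U' x₀ := hfU.fderiv_eq
  have e2 : fderiv ℝ (fderiv ℝ f) (U x₀) = fderiv ℝ f' (U x₀) := hff.fderiv_eq
  rw [e1, e2, hfU0, hff0]
  simp only [_root_.add_apply, ContinuousLinearMap.comp_apply, ContinuousLinearMap.compL_apply,
    ContinuousLinearMap.flip_apply]
  rw [add_comm]

/-- [folklore] **TADPOLE-FREE CASE**: if `f` has NO first jet at `U x₀` (`df(U x₀) = 0`), the second jet of `f ∘ U` is the transported second jet ONLY: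
`d²(f ∘ U)(x₀)[u][v] = d²f(U x₀)[dU u][dU v]`. -/
theorem fderiv_fderiv_comp_of_fderiv_eq_zero {U : E → F} {f : F → G} {x₀ : E} (hU : ContDiffAt ℝ 2 U x₀)
    (hf : ContDiffAt ℝ 2 f (U x₀)) (htad : fderiv ℝ f (U x₀) = 0) (u v : E) :
    fderiv ℝ (fderiv ℝ (f ∘ U)) x₀ u v = fderiv ℝ (fderiv ℝ f) (U x₀) (fderiv ℝ U x₀ u) (fderiv ℝ U x₀ v) := by
  rw [fderiv_fderiv_comp hU hf, htad, _root_.zero_apply, add_zero]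

/-! ## §2 The step defect under a Fubini hypothesis -/

/-- [folklore] **THE STEP DEFECT IS THE FIRST JET CONTRACTED WITH THE SECOND RESPONSE.**  Let `Φ` (the «one-shot functional at the next level»)
agree near `x₀` with `f ∘ U + φ + c` (`f` the «one-shot functional at this level», `U` the «last step's minimiser map», `φ` the «last step's
functional», `c` a constant — the FUBINI hypothesis, as FUNCTIONS), with `U`, `φ` of class `C²` at `x₀` and `f` of class `C²` at `U x₀`.  Then
`d²Φ(x₀)[u][v] − d²f(U x₀)[dU u][dU v] − d²φ(x₀)[u][v] = df(U x₀)(d²U(x₀)[u][v])`. -/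
theorem stepDefect_eq_firstJet_secondResponse {Φ φ : E → G} {U : E → F} {f : F → G} {x₀ : E} {c : G}
    (hΦ : Φ =ᶠ[𝓝 x₀] fun x => f (U x) + φ x + c) (hU : ContDiffAt ℝ 2 U x₀) (hf : ContDiffAt ℝ 2 f (U x₀))
    (hφ : ContDiffAt ℝ 2 φ x₀) (u v : E) :
    fderiv ℝ (fderiv ℝ Φ) x₀ u v - fderiv ℝ (fderiv ℝ f) (U x₀) (fderiv ℝ U x₀ u) (fderiv ℝ U x₀ v) - fderiv ℝ (fderiv ℝ φ) x₀ u v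
      = fderiv ℝ f (U x₀) (fderiv ℝ (fderiv ℝ U) x₀ u v) := by
  -- `C²` data of the pieces
  have hfU : ContDiffAt ℝ 2 (f ∘ U) x₀ := hf.comp x₀ hU
  have hsum : ContDiffAt ℝ 2 (fun x => f (U x) + φ x + c) x₀ := (hfU.add hφ).add contDiffAt_const
  -- second derivatives of `Φ` and of the sum agree
  have hΦ2 : fderiv ℝ (fderiv ℝ Φ) x₀ = fderiv ℝ (fderiv ℝ (fun x => f (U x) + φ x + c)) x₀ := by
    have h1 : fderiv ℝ Φ =ᶠ[𝓝 x₀] fderiv ℝ (fun x => f (U x) + φ x + c) := hΦ.fderiv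
    exact h1.fderiv_eq
  -- split the second derivative of the sum
  obtain ⟨W', hW', hW'1⟩ := exists_local_fderiv hfU
  obtain ⟨φ', hφ', hφ'1⟩ := exists_local_fderiv hφ
  have hfield : fderiv ℝ (fun x => f (U x) + φ x + c) =ᶠ[𝓝 x₀] fun x => W' x + φ' x :=
    (hW'.and hφ').mono fun x hx => ((hx.1.add hx.2).add_const c).fderiv
  have hdW : HasFDerivAt W' (fderiv ℝ W' x₀) x₀ := (hW'1.differentiableAt one_ne_zero).hasFDerivAt
  have hdφ : HasFDerivAt φ' (fderiv ℝ φ' x₀) x₀ := (hφ'1.differentiableAt one_ne_zero).hasFDerivAt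
  have h2 := (hdW.add hdφ).congr_of_eventuallyEq hfield
  have eW' : fderiv ℝ (f ∘ U) =ᶠ[𝓝 x₀] W' := hW'.mono fun x hx => hx.fderiv
  have eφ' : fderiv ℝ φ =ᶠ[𝓝 x₀] φ' := hφ'.mono fun x hx => hx.fderiv
  have eW : fderiv ℝ (fderiv ℝ (f ∘ U)) x₀ = fderiv ℝ W' x₀ := eW'.fderiv_eq
  have eφ : fderiv ℝ (fderiv ℝ φ) x₀ = fderiv ℝ φ' x₀ := eφ'.fderiv_eq
  rw [hΦ2, h2.fderiv, _root_.add_apply, _root_.add_apply, ← eW, ← eφ,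
    fderiv_fderiv_comp hU hf]
  abel

/-- [folklore] **TADPOLE-FREE ⟹ ZERO STEP DEFECT**: under the Fubini hypothesis, if the one-shot functional at this level has no first jet at the
image of the base point (`df(U x₀) = 0`), then `d²Φ(x₀)[u][v] = d²f(U x₀)[dU u][dU v] + d²φ(x₀)[u][v]` — the next level's second jet is EXACTLY the
transported second jet plus the step's second jet. -/
theorem stepDefect_eq_zero_of_tadpoleFree {Φ φ : E → G} {U : E → F} {f : F → G} {x₀ : E} {c : G}
    (hΦ : Φ =ᶠ[𝓝 x₀] fun x => f (U x) + φ x + c) (hU : ContDiffAt ℝ 2 U x₀) (hf : ContDiffAt ℝ 2 f (U x₀))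
    (hφ : ContDiffAt ℝ 2 φ x₀) (htad : fderiv ℝ f (U x₀) = 0) (u v : E) :
    fderiv ℝ (fderiv ℝ Φ) x₀ u v - fderiv ℝ (fderiv ℝ f) (U x₀) (fderiv ℝ U x₀ u) (fderiv ℝ U x₀ v) - fderiv ℝ (fderiv ℝ φ) x₀ u v
      = 0 := by
  rw [stepDefect_eq_firstJet_secondResponse hΦ hU hf hφ, htad, _root_.zero_apply]

/-- [folklore] The same, solved for the next level's second jet. -/
theorem secondJet_oneShot_eq_of_tadpoleFree {Φ φ : E → G} {U : E → F} {f : F → G} {x₀ : E} {c : G}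
    (hΦ : Φ =ᶠ[𝓝 x₀] fun x => f (U x) + φ x + c) (hU : ContDiffAt ℝ 2 U x₀) (hf : ContDiffAt ℝ 2 f (U x₀))
    (hφ : ContDiffAt ℝ 2 φ x₀) (htad : fderiv ℝ f (U x₀) = 0) (u v : E) :
    fderiv ℝ (fderiv ℝ Φ) x₀ u v
      = fderiv ℝ (fderiv ℝ f) (U x₀) (fderiv ℝ U x₀ u) (fderiv ℝ U x₀ v) + fderiv ℝ (fderiv ℝ φ) x₀ u v := by
  have h := stepDefect_eq_zero_of_tadpoleFree hΦ hU hf hφ htad u v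
  rw [sub_sub, sub_eq_zero] at h
  exact h

end Summit.QuantumFields.BalabanUV.Beta.StepDefectTadpole
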